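import Summits.QuantumFields.GaugeBoot.BootstrapTranslationAveraging
import Summits.QuantumFields.GaugeBoot.BootstrapCertificatesZd
import HarnessLib

/-!
# The translation-reduced bootstrap on `ℤ^d` ("Wilson loops modulo translations"): `SU(N)`, any `β`, any level (gauge-boot, L1/L4 supplement)

HONEST FRAMING (cell `pub-gaugeboot`, page 1 of every file): the venture produces certified bounds
on lattice expectations at stated coupling, gauge group, dimension and torus size; NOT a mass gap,
NOT a continuum limit, NOT a string tension; NOT Yang–Mills-summit-bearing (barriers
`FixedCouplingUltralocality`, `PerturbativeInvisibility`). Structural; it certifies no number.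

## Content (`SU(N)` on the infinite lattice `ℤ^d`, one-link Wilson boundary actions, word level `n`)

The infinite-lattice bootstrap of Anderson–Kruczenski and Kazakov–Zheng does not optimise over all
level-`n` feasible functionals: its variables are Wilson loops LABELLED BY SHAPE, i.e. the
level-`n` functionals which are translation invariant on the words. On the torus this reduction is
lossless for invariant objectives (`BootstrapSymmetryReduction`); on `ℤ^d` no non-constant local
objective is invariant, and the right statements are:

* `levelValuesZdSuN N β n P` (plain level-`n` values) ⊇ ★ `symLevelValuesZdSuN N β n P` (values
  over level-`n` feasible functionals invariant under all translations on the words of length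
  `≤ 2n` — every entry of the level-`n` moment matrix identified modulo translations);
  `symLevelValuesZd_subset_levelValuesZd`, `symLevelValuesZd_anti` (higher level, fewer values),
  `convex_symLevelValuesZd`;
* ★★ SOUNDNESS `dlr_integral_mem_symLevelValuesZd` — the expectation in every TRANSLATION-INVARIANT
  infinite-volume Gibbs state is reduced-feasible at every level (so a reduced certificate bounds
  every homogeneous phase; a plain certificate bounds every phase, `BootstrapCertificatesZd`);
* ★★★ `exists_translationInvariant_feasible_zdSuN` — the Reynolds operator
  (`BootstrapTranslationAveraging`): every plain level-`n` solution `φ` has a reduced level-`n`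
  solution `ψ`, invariant on the whole level-`n` certificate domain, with
  `ψ x = zdMean (v ↦ φ (x ∘ τ_v))` there;
* ★★★ `symLevelValuesZd_eq_setOf_zdMean` — for `P` a combination of words of length `≤ 2n`, the
  REDUCED level-`n` feasible values of `P` are EXACTLY the invariant means `zdMean (v ↦ φ (P ∘ τ_v))`
  over the PLAIN level-`n` solutions `φ`; hence ★★ `exists_mem_symLevelValuesZd_mem_Icc` (between
  `inf_v φ (P ∘ τ_v)` and `sup_v φ (P ∘ τ_v)` of every plain solution lies a reduced value), ★★
  `apply_mem_symLevelValuesZd_of_forall_translate` (a plain solution homogeneous on the orbit of `P`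
  gives a reduced value), `symLevelValuesZd_nonempty`;
* ★★ `symLevelValuesZd_subset_levelValuesZd_finsetAvg` — at fixed level the reduced SDP bounds `P`
  at least as well as the plain SDP bounds ANY finite translation average of `P` (on the torus the
  full average gives equality, `symLevelValues_eq_levelValues_avgObs_suN`).

What this is NOT: whether the reduced level-`n` bound on a single Wilson loop is STRICTLY better
than the plain one is not claimed either way (the limits `n → ∞` are compared in
`SymmetricBootstrapConvergenceZd.lean`: plain → all Gibbs states, reduced → the translation-invariant
ones); no hyperoctahedral point group here (finite — the torus file's averaging applies verbatim);
no rates.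

References: P. Anderson, M. Kruczenski, Nucl. Phys. B 921 (2017) §3; V. Kazakov, Z. Zheng,
arXiv:2203.11360 §3.2–3.3; K. Gatermann, P. A. Parrilo, J. Pure Appl. Algebra 192 (2004) 95;
H.-O. Georgii, Gibbs Measures and Phase Transitions (2011) Ch. 5 (shift-invariant Gibbs measures).
Folklore.
-/

noncomputable section

open MeasureTheory Filter Topology NormedSpace
open Literature.MathematicalPhysics.QuantumFieldTheory (LatticeRep)
open Literature.MathematicalPhysics.QuantumLattice

namespace Summit.QuantumFields.GaugeBoot

section ZdSuN

variable {d : ℕ} (N : ℕ) (β : ℝ)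

/-- **The plain level-`n` feasible values on `ℤ^d`** (`SU(N)`, one-link Wilson boundary actions):
`feasibleValues` of `BootstrapCertificateCompleteness` in this instance. [folklore] -/
abbrev levelValuesZdSuN (n : ℕ) (P : C(LGConfig d (Matrix.specialUnitaryGroup (Fin N) ℂ), ℝ)) : Set ℝ :=
  feasibleValues (fundamentalLatticeRep N) (suExp N)
    (fun e => wilsonBoundaryAction (fundamentalRep (Fin N)) {e}) β n P

/-- ★ **The translation-reduced level-`n` SDP of Anderson–Kruczenski / Kazakov–Zheng on `ℤ^d`**:
the values `φ P` over the level-`n` feasible functionals which are moreover TRANSLATION INVARIANT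
on the words of length `≤ 2n` (every entry of the level-`n` moment matrix identified with all its
translates — "Wilson loops labelled by shape"). [folklore] -/
def symLevelValuesZdSuN (n : ℕ) (P : C(LGConfig d (Matrix.specialUnitaryGroup (Fin N) ℂ), ℝ)) : Set ℝ :=
  {t | ∃ φ : C(LGConfig d (Matrix.specialUnitaryGroup (Fin N) ℂ), ℝ) →ₗ[ℝ] ℝ,
    IsBootstrapFeasible (fundamentalLatticeRep N) (suExp N)
        (fun e => wilsonBoundaryAction (fundamentalRep (Fin N)) {e}) β
        (wordTruncation (ι := ZdEdge d) (fundamentalLatticeRep N) n) φ ∧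
      (∀ (v : Fin d → ℤ), ∀ x ∈ wordTruncation (ι := ZdEdge d) (fundamentalLatticeRep N) (n + n),
        φ (x.comp (relabelCM (G := Matrix.specialUnitaryGroup (Fin N) ℂ) (edgeShift v))) = φ x) ∧
      φ P = t}

/-- The one-link Wilson boundary actions of `SU(N)` are translation covariant. -/
theorem wilsonBoundaryAction_translationCovariant_suN (v : Fin d → ℤ) (e : ZdEdge d)
    (U : LGConfig d (Matrix.specialUnitaryGroup (Fin N) ℂ)) :
    (fun e => wilsonBoundaryAction (fundamentalRep (Fin N)) {e}) e
        (relabelCM (G := Matrix.specialUnitaryGroup (Fin N) ℂ) (edgeShift v) U) =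
      (fun e => wilsonBoundaryAction (fundamentalRep (Fin N)) {e}) (edgeShift v e) U :=
  wilsonBoundaryAction_single_relabelCM_edgeShift (fundamentalRep (Fin N)) v e U

/-- Imposing translation invariance shrinks the feasible set. -/
theorem symLevelValuesZd_subset_levelValuesZd (n : ℕ)
    (P : C(LGConfig d (Matrix.specialUnitaryGroup (Fin N) ℂ), ℝ)) :
    symLevelValuesZdSuN (d := d) N β n P ⊆ levelValuesZdSuN (d := d) N β n P := by
  rintro t ⟨φ, hφ, -, rfl⟩
  exact ⟨φ, hφ, rfl⟩

/-- **Higher level, fewer reduced values** (more test functions, more identifications). -/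
theorem symLevelValuesZd_anti {m n : ℕ} (hmn : n ≤ m)
    (P : C(LGConfig d (Matrix.specialUnitaryGroup (Fin N) ℂ), ℝ)) :
    symLevelValuesZdSuN (d := d) N β m P ⊆ symLevelValuesZdSuN (d := d) N β n P := by
  rintro t ⟨φ, hφ, hinv, rfl⟩
  exact ⟨φ, hφ.mono (fundamentalLatticeRep N) (wordTruncation_mono _ hmn),
    fun v x hx => hinv v x (wordTruncation_mono _ (Nat.add_le_add hmn hmn) hx), rfl⟩

/-- **The reduced feasible values form a convex set.** -/
theorem convex_symLevelValuesZd (n : ℕ) (P : C(LGConfig d (Matrix.specialUnitaryGroup (Fin N) ℂ), ℝ)) :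
    Convex ℝ (symLevelValuesZdSuN (d := d) N β n P) := by
  rintro _ ⟨φ, hφ, hφi, rfl⟩ _ ⟨ψ, hψ, hψi, rfl⟩ a b ha hb hab
  refine ⟨a • φ + b • ψ, feasible_convex (fundamentalLatticeRep N) hφ hψ ha hb hab, fun v x hx => ?_, ?_⟩
  · simp only [LinearMap.add_apply, LinearMap.smul_apply, hφi v x hx, hψi v x hx]
  · simp only [LinearMap.add_apply, LinearMap.smul_apply, smul_eq_mul]

/-! ### Soundness for the homogeneous phases -/

/-- ★★ **Every translation-invariant infinite-volume Gibbs state is reduced-feasible at every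
level**: its expectation of `P` is a value of the translation-reduced level-`n` SDP. (A plain
level-`n` certificate bounds every Gibbs state; a reduced one bounds every translation-invariant
Gibbs state.) [folklore] -/
theorem dlr_integral_mem_symLevelValuesZd (n : ℕ)
    {μ : Measure (LGConfig d (Matrix.specialUnitaryGroup (Fin N) ℂ))}
    (hμ : μ ∈ ymGibbsMeasures (d := d) (fundamentalRep (Fin N)) β) (hT : IsZdTranslationInvariant μ)
    (P : C(LGConfig d (Matrix.specialUnitaryGroup (Fin N) ℂ), ℝ)) :
    ∫ U, P U ∂μ ∈ symLevelValuesZdSuN (d := d) N β n P := by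
  haveI := hμ.1
  refine ⟨expectationFunctional μ, isBootstrapFeasible_dlr_suN N β hμ (wordTruncation_subset_polyAlgebra _ n),
    fun v x _ => ?_, rfl⟩
  rw [expectationFunctional_apply, expectationFunctional_apply]
  have hmp : MeasurePreserving (configShift (G := Matrix.specialUnitaryGroup (Fin N) ℂ) (-v)) μ μ :=
    ⟨(configShift _).measurable, hT (-v)⟩
  have h := hmp.integral_comp (configShift (-v)).measurableEmbedding (fun U => x U)
  simp only [ContinuousMap.comp_apply, relabelCM_edgeShift_eq_configShift]
  exact h

/-! ### The Reynolds operator and the reduced values as invariant means -/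

/-- ★★★ **Every plain level-`n` solution has a translation-invariant level-`n` solution** (`SU(N)`
on `ℤ^d`, any real `β`, any `n`): invariant on the whole level-`n` certificate domain
`certDomainZdSuN N β n` (words of length `≤ 2n` and rows), with values there the invariant means
`zdMean (v ↦ φ (x ∘ τ_v))` of the translates' values — between their infimum and supremum, equal to
`φ x` when the orbit is constant. [cite: GatermannParrilo2004, Thm 3.3 (Reynolds operator; here the
invariant mean of `ℤ^d`)] -/
theorem exists_translationInvariant_feasible_zdSuN {n : ℕ}
    {φ : C(LGConfig d (Matrix.specialUnitaryGroup (Fin N) ℂ), ℝ) →ₗ[ℝ] ℝ}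
    (hφ : IsBootstrapFeasible (fundamentalLatticeRep N) (suExp N)
      (fun e => wilsonBoundaryAction (fundamentalRep (Fin N)) {e}) β
      (wordTruncation (ι := ZdEdge d) (fundamentalLatticeRep N) n) φ) :
    ∃ ψ : C(LGConfig d (Matrix.specialUnitaryGroup (Fin N) ℂ), ℝ) →ₗ[ℝ] ℝ,
      IsBootstrapFeasible (fundamentalLatticeRep N) (suExp N)
          (fun e => wilsonBoundaryAction (fundamentalRep (Fin N)) {e}) β
          (wordTruncation (ι := ZdEdge d) (fundamentalLatticeRep N) n) ψ ∧
      (∀ (a : Fin d → ℤ), ∀ x ∈ certDomainZdSuN (d := d) N β n,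
        ψ (x.comp (relabelCM (G := Matrix.specialUnitaryGroup (Fin N) ℂ) (edgeShift a))) = ψ x) ∧
      (∀ x ∈ certDomainZdSuN (d := d) N β n,
        ψ x = zdMean d fun v => φ (x.comp (relabelCM (G := Matrix.specialUnitaryGroup (Fin N) ℂ) (edgeShift v)))) ∧
      (∀ x ∈ certDomainZdSuN (d := d) N β n, ∀ lo hi : ℝ,
        (∀ v : Fin d → ℤ, lo ≤ φ (x.comp (relabelCM (G := Matrix.specialUnitaryGroup (Fin N) ℂ) (edgeShift v)))) →
        (∀ v : Fin d → ℤ, φ (x.comp (relabelCM (G := Matrix.specialUnitaryGroup (Fin N) ℂ) (edgeShift v))) ≤ hi) →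
          ψ x ∈ Set.Icc lo hi) ∧
      (∀ x : C(LGConfig d (Matrix.specialUnitaryGroup (Fin N) ℂ), ℝ),
        (∀ v : Fin d → ℤ, φ (x.comp (relabelCM (G := Matrix.specialUnitaryGroup (Fin N) ℂ) (edgeShift v))) = φ x) →
          ψ x = φ x) :=
  exists_translationInvariant_feasible (fundamentalLatticeRep N)
    (wilsonBoundaryAction_translationCovariant_suN N) hφ

/-- ★★★ **The reduced level-`n` values of a word combination `P` of length `≤ 2n` are exactly the
invariant means of its translates' values over the PLAIN level-`n` solutions**:
`symLevelValues_n(P) = {zdMean (v ↦ φ (P ∘ τ_v)) : φ plain level-n feasible}`. [folklore] -/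
theorem symLevelValuesZd_eq_setOf_zdMean {n : ℕ}
    {P : C(LGConfig d (Matrix.specialUnitaryGroup (Fin N) ℂ), ℝ)}
    (hP : P ∈ wordTruncation (ι := ZdEdge d) (fundamentalLatticeRep N) (n + n)) :
    symLevelValuesZdSuN (d := d) N β n P =
      {t | ∃ φ : C(LGConfig d (Matrix.specialUnitaryGroup (Fin N) ℂ), ℝ) →ₗ[ℝ] ℝ,
        IsBootstrapFeasible (fundamentalLatticeRep N) (suExp N)
            (fun e => wilsonBoundaryAction (fundamentalRep (Fin N)) {e}) β
            (wordTruncation (ι := ZdEdge d) (fundamentalLatticeRep N) n) φ ∧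
          zdMean d (fun v => φ (P.comp (relabelCM (G := Matrix.specialUnitaryGroup (Fin N) ℂ) (edgeShift v)))) = t} := by
  ext t
  constructor
  · rintro ⟨φ, hφ, hinv, rfl⟩
    exact ⟨φ, hφ, zdMean_eq_of_forall_eq fun v => hinv v P hP⟩
  · rintro ⟨φ, hφ, rfl⟩
    obtain ⟨ψ, hψ, hinv, hmean, -, -⟩ := exists_translationInvariant_feasible_zdSuN N β hφ
    exact ⟨ψ, hψ, fun v x hx => hinv v x (mem_certDomain_of_mem_wordTruncation _ hx),
      hmean P (mem_certDomain_of_mem_wordTruncation _ hP)⟩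

/-- ★★ **Between the infimum and the supremum of the translates' values of any plain solution lies
a reduced value** (`P` in the level-`n` certificate domain). -/
theorem exists_mem_symLevelValuesZd_mem_Icc {n : ℕ}
    {P : C(LGConfig d (Matrix.specialUnitaryGroup (Fin N) ℂ), ℝ)}
    (hP : P ∈ certDomainZdSuN (d := d) N β n)
    {φ : C(LGConfig d (Matrix.specialUnitaryGroup (Fin N) ℂ), ℝ) →ₗ[ℝ] ℝ}
    (hφ : IsBootstrapFeasible (fundamentalLatticeRep N) (suExp N)
      (fun e => wilsonBoundaryAction (fundamentalRep (Fin N)) {e}) β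
      (wordTruncation (ι := ZdEdge d) (fundamentalLatticeRep N) n) φ)
    {lo hi : ℝ}
    (hlo : ∀ v : Fin d → ℤ, lo ≤ φ (P.comp (relabelCM (G := Matrix.specialUnitaryGroup (Fin N) ℂ) (edgeShift v))))
    (hhi : ∀ v : Fin d → ℤ, φ (P.comp (relabelCM (G := Matrix.specialUnitaryGroup (Fin N) ℂ) (edgeShift v))) ≤ hi) :
    ∃ t ∈ symLevelValuesZdSuN (d := d) N β n P, t ∈ Set.Icc lo hi := by
  obtain ⟨ψ, hψ, hinv, -, hIcc, -⟩ := exists_translationInvariant_feasible_zdSuN N β hφ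
  exact ⟨ψ P, ⟨ψ, hψ, fun v x hx => hinv v x (mem_certDomain_of_mem_wordTruncation _ hx), rfl⟩,
    hIcc P hP lo hi hlo hhi⟩

/-- ★★ **A plain solution which is homogeneous on the orbit of `P` yields a reduced value**: if
`φ (P ∘ τ_v) = φ P` for every translation `v`, then `φ P` is a reduced level-`n` value of `P`
(any observable `P`). -/
theorem apply_mem_symLevelValuesZd_of_forall_translate {n : ℕ}
    {φ : C(LGConfig d (Matrix.specialUnitaryGroup (Fin N) ℂ), ℝ) →ₗ[ℝ] ℝ}
    (hφ : IsBootstrapFeasible (fundamentalLatticeRep N) (suExp N)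
      (fun e => wilsonBoundaryAction (fundamentalRep (Fin N)) {e}) β
      (wordTruncation (ι := ZdEdge d) (fundamentalLatticeRep N) n) φ)
    {P : C(LGConfig d (Matrix.specialUnitaryGroup (Fin N) ℂ), ℝ)}
    (h : ∀ v : Fin d → ℤ, φ (P.comp (relabelCM (G := Matrix.specialUnitaryGroup (Fin N) ℂ) (edgeShift v))) = φ P) :
    φ P ∈ symLevelValuesZdSuN (d := d) N β n P := by
  obtain ⟨ψ, hψ, hinv, -, -, hconst⟩ := exists_translationInvariant_feasible_zdSuN N β hφ
  exact ⟨ψ, hψ, fun v x hx => hinv v x (mem_certDomain_of_mem_wordTruncation _ hx), hconst P h⟩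

/-- ★★ **The reduced SDP is feasible at every level and every `β`** (a DLR state exists and is
averaged). -/
theorem symLevelValuesZd_nonempty (n : ℕ) (P : C(LGConfig d (Matrix.specialUnitaryGroup (Fin N) ℂ), ℝ)) :
    (symLevelValuesZdSuN (d := d) N β n P).Nonempty := by
  obtain ⟨φ, hφ⟩ := exists_zdFeasible_suN (d := d) N β n
  obtain ⟨ψ, hψ, hinv, -⟩ := exists_translationInvariant_feasible_zdSuN N β hφ
  exact ⟨ψ P, ψ, hψ, fun v x hx => hinv v x (mem_certDomain_of_mem_wordTruncation _ hx), rfl⟩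

/-! ### Fixed level: the reduced SDP versus translation averages of the objective -/

/-- ★★ **The reduced SDP bounds `P` at least as well as the plain SDP bounds any finite translation
average of `P`**: for `P` a combination of words of length `≤ 2n` and a non-empty finite set `B` of
translations, every reduced level-`n` value of `P` is a plain level-`n` value of
`|B|⁻¹ Σ_{b ∈ B} P ∘ τ_b`. (On the torus the average over ALL translations gives equality.)
[folklore] -/
theorem symLevelValuesZd_subset_levelValuesZd_finsetAvg {n : ℕ}
    {P : C(LGConfig d (Matrix.specialUnitaryGroup (Fin N) ℂ), ℝ)}
    (hP : P ∈ wordTruncation (ι := ZdEdge d) (fundamentalLatticeRep N) (n + n))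
    {B : Finset (Fin d → ℤ)} (hB : B.Nonempty) :
    symLevelValuesZdSuN (d := d) N β n P ⊆
      levelValuesZdSuN (d := d) N β n
        ((B.card : ℝ)⁻¹ • ∑ b ∈ B, P.comp (relabelCM (G := Matrix.specialUnitaryGroup (Fin N) ℂ) (edgeShift b))) := by
  rintro t ⟨φ, hφ, hinv, rfl⟩
  refine ⟨φ, hφ, ?_⟩
  rw [map_smul, map_sum, smul_eq_mul]
  have h : ∀ b ∈ B, φ (P.comp (relabelCM (G := Matrix.specialUnitaryGroup (Fin N) ℂ) (edgeShift b))) = φ P :=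
    fun b _ => hinv b P hP
  rw [Finset.sum_congr rfl h, Finset.sum_const, nsmul_eq_mul]
  have hc : (B.card : ℝ) ≠ 0 := Nat.cast_ne_zero.2 (Finset.card_pos.2 hB).ne'
  field_simp

/-- **The reduced values of `P` and of each of its translates coincide** (`P` of length `≤ 2n`). -/
theorem symLevelValuesZd_comp_eq {n : ℕ}
    {P : C(LGConfig d (Matrix.specialUnitaryGroup (Fin N) ℂ), ℝ)}
    (hP : P ∈ wordTruncation (ι := ZdEdge d) (fundamentalLatticeRep N) (n + n)) (a : Fin d → ℤ) :
    symLevelValuesZdSuN (d := d) N β n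
        (P.comp (relabelCM (G := Matrix.specialUnitaryGroup (Fin N) ℂ) (edgeShift a))) =
      symLevelValuesZdSuN (d := d) N β n P := by
  ext t
  constructor
  · rintro ⟨φ, hφ, hinv, rfl⟩
    exact ⟨φ, hφ, hinv, (hinv a P hP).symm⟩
  · rintro ⟨φ, hφ, hinv, rfl⟩
    exact ⟨φ, hφ, hinv, hinv a P hP⟩

end ZdSuN

end Summit.QuantumFields.GaugeBoot

end
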